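import Mathlib

/-!
# `SnSubsetDichotomy.PolynomialSlack`, line `transport-split-hull` — the ball certificate

Crux `Summit.MatrixMultiplication.MatrixMultiplication.Theses.SnSubsetDichotomy.PolynomialSlack`
(item `stmt-MatrixMultiplication-8306`), level-one programme on triples `S, T, U ⊆ S_n` with the
triple product property, lead c5, line `transport-split-hull`: the registered stubs
`ball_certificate`, `contraction_sq_sum_le` and `gram_quadForm_ge` (ENERGY FLOOR CHAIN).

For a set `X ⊆ S_n` its profile `d_X(v,i) = P(x i = v)` is doubly stochastic, `Δ_X = d_X - 1/n`
and `E_X = Δ_X Δ_Xᵀ ⪰ 0` is a contraction.  The three lemmas of this file give, in elementary sum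
form, the local bound `uᵀ E_S E_T u ≥ -‖u‖² / 8` (the numerical-range constant `1/8` for a product
of two positive semidefinite contractions):

* `ball_certificate` — if `‖x‖² ≤ ⟨x, u⟩` and `‖y‖² ≤ ⟨y, u⟩` then `-⟨x, y⟩ ≤ ‖u‖² / 8`
  (expand `0 ≤ ‖x + y - u/2‖²`);
* `contraction_sq_sum_le` — for a doubly stochastic `d`, `‖(d - 1/n) z‖² ≤ ‖z‖²`
  (centre `z`, Jensen in each row, column sums);
* `gram_quadForm_ge` — the bound `-uᵀ E_S E_T u ≤ ‖u‖² / 8`, from the previous two items with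
  `x = E_S u`, `y = E_T u`.

Mathlib only.
-/

-- `Summit.<Summit>.<Problem>` is the tree's mandated summit-side namespace; for this
-- single-conjunct summit the two coincide, so the file silences `dupNamespace`.
set_option linter.dupNamespace false

open scoped BigOperators

namespace Summit.MatrixMultiplication.MatrixMultiplication.Theorems.PolynomialSlack

/-- **Ball certificate.** If `∑ x² ≤ ∑ x u` and `∑ y² ≤ ∑ y u` (i.e. `x` and `y` lie in the ball
with diameter `[0, u]`), then `-∑ x y ≤ (∑ u²) / 8`: expand
`0 ≤ ∑ (x + y - u/2)² = ∑ x² + ∑ y² + ∑ u²/4 + 2 ∑ x y - ∑ x u - ∑ y u`. [folklore] -/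
theorem ball_certificate {ι : Type*} [Fintype ι] (x y u : ι → ℝ)
    (hx : ∑ w, x w ^ 2 ≤ ∑ w, x w * u w) (hy : ∑ w, y w ^ 2 ≤ ∑ w, y w * u w) :
    -(∑ w, x w * y w) ≤ (∑ w, u w ^ 2) / 8 := by
  have h : (0 : ℝ) ≤ ∑ w, (x w + y w - u w / 2) ^ 2 :=
    Finset.sum_nonneg fun w _ => sq_nonneg _
  have hexp : ∀ w, (x w + y w - u w / 2) ^ 2 =
      x w ^ 2 + y w ^ 2 + u w ^ 2 / 4 + 2 * (x w * y w) - x w * u w - y w * u w :=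
    fun w => by ring
  simp only [hexp, Finset.sum_add_distrib, Finset.sum_sub_distrib, ← Finset.sum_div,
    ← Finset.mul_sum] at h
  linarith

/-- **Jensen in a row.** For nonnegative weights `p i` with `∑ p = 1`,
`(∑ p i * w i)² ≤ ∑ p i * (w i)²` (expand `0 ≤ ∑ p i * (w i - m)²` with `m = ∑ p i * w i`).
[folklore] -/
private theorem sq_weightedSum_le_weightedSum_sq {ι : Type*} [Fintype ι] (p w : ι → ℝ)
    (hp : ∀ i, 0 ≤ p i) (hp1 : ∑ i, p i = 1) :
    (∑ i, p i * w i) ^ 2 ≤ ∑ i, p i * w i ^ 2 := by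
  obtain ⟨m, hm⟩ : ∃ m : ℝ, ∑ i, p i * w i = m := ⟨_, rfl⟩
  have h0 : (0 : ℝ) ≤ ∑ i, p i * (w i - m) ^ 2 :=
    Finset.sum_nonneg fun i _ => mul_nonneg (hp i) (sq_nonneg _)
  have hexp : ∀ i, p i * (w i - m) ^ 2 = p i * w i ^ 2 - 2 * m * (p i * w i) + m ^ 2 * p i :=
    fun i => by ring
  simp only [hexp, Finset.sum_add_distrib, Finset.sum_sub_distrib, ← Finset.mul_sum, hm,
    hp1] at h0
  rw [hm]
  nlinarith [h0]

/-- **Contraction.** For a doubly stochastic `n × n` matrix `d` (nonnegative entries, all row and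
column sums `1`) and any `z`, `∑_v (∑_i (d v i - 1/n) z i)² ≤ ∑_i (z i)²`: with
`z̄ = (∑ z)/n` one has `∑_i (d v i - 1/n) z i = ∑_i d v i (z i - z̄)`, Jensen in each row gives
`(∑_i d v i (z i - z̄))² ≤ ∑_i d v i (z i - z̄)²`, and summing over `v` (column sums `1`) leaves
`∑_i (z i - z̄)² = ∑ z² - n z̄² ≤ ∑ z²`. [folklore] -/
theorem contraction_sq_sum_le {n : ℕ} (d : Fin n → Fin n → ℝ) (hd : ∀ v i, 0 ≤ d v i)
    (hrow : ∀ v, ∑ i, d v i = 1) (hcol : ∀ i, ∑ v, d v i = 1) (z : Fin n → ℝ) :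
    ∑ v, (∑ i, (d v i - 1 / n) * z i) ^ 2 ≤ ∑ i, z i ^ 2 := by
  rcases Nat.eq_zero_or_pos n with rfl | hn
  · simp
  have hn' : (n : ℝ) ≠ 0 := Nat.cast_ne_zero.mpr hn.ne'
  -- the mean of `z`
  obtain ⟨zbar, hz⟩ : ∃ zbar : ℝ, ∑ i, z i = n * zbar :=
    ⟨(∑ i, z i) / n, by field_simp⟩
  -- centring each row
  have h1 : ∀ v, ∑ i, (d v i - 1 / n) * z i = ∑ i, d v i * (z i - zbar) := by
    intro v
    simp only [sub_mul, mul_sub, Finset.sum_sub_distrib, ← Finset.mul_sum, ← Finset.sum_mul,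
      hrow v, one_mul, hz]
    field_simp
  -- Jensen in each row, then sum over the rows and use the column sums
  have h2 : ∑ v, (∑ i, d v i * (z i - zbar)) ^ 2 ≤ ∑ i, (z i - zbar) ^ 2 := by
    calc ∑ v, (∑ i, d v i * (z i - zbar)) ^ 2
        ≤ ∑ v, ∑ i, d v i * (z i - zbar) ^ 2 :=
          Finset.sum_le_sum fun v _ =>
            sq_weightedSum_le_weightedSum_sq (d v) (fun i => z i - zbar) (hd v) (hrow v)
      _ = ∑ i, (z i - zbar) ^ 2 := by
          rw [Finset.sum_comm]
          refine Finset.sum_congr rfl fun i _ => ?_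
          rw [← Finset.sum_mul, hcol i, one_mul]
  -- the centred vector is shorter
  have h3 : ∑ i, (z i - zbar) ^ 2 ≤ ∑ i, z i ^ 2 := by
    have hexp : ∀ i, (z i - zbar) ^ 2 = z i ^ 2 - 2 * zbar * z i + zbar ^ 2 := fun i => by ring
    simp only [hexp, Finset.sum_add_distrib, Finset.sum_sub_distrib, ← Finset.mul_sum, hz,
      Finset.sum_const, Finset.card_univ, Fintype.card_fin, nsmul_eq_mul]
    nlinarith [mul_nonneg (Nat.cast_nonneg n : (0 : ℝ) ≤ n) (sq_nonneg zbar)]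
  calc ∑ v, (∑ i, (d v i - 1 / n) * z i) ^ 2
      = ∑ v, (∑ i, d v i * (z i - zbar)) ^ 2 := by simp only [h1]
    _ ≤ ∑ i, (z i - zbar) ^ 2 := h2
    _ ≤ ∑ i, z i ^ 2 := h3

/-- **Second moment step.** For a doubly stochastic `d` and `s i = ∑_v (d v i - 1/n) u v`,
`x w = ∑_i (d w i - 1/n) s i` (that is `x = Δ Δᵀ u`), one has `∑ x² ≤ ∑ x u`: indeed
`∑ x u = ∑ s²` (swap the sums) and `∑ x² ≤ ∑ s²` is `contraction_sq_sum_le`. [folklore] -/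
private theorem gram_sq_sum_le_gram_inner {n : ℕ} (d : Fin n → Fin n → ℝ)
    (hd : ∀ v i, 0 ≤ d v i) (hrow : ∀ v, ∑ i, d v i = 1) (hcol : ∀ i, ∑ v, d v i = 1)
    (u : Fin n → ℝ) :
    ∑ w, (∑ i, (d w i - 1 / n) * ∑ v, (d v i - 1 / n) * u v) ^ 2 ≤
      ∑ w, (∑ i, (d w i - 1 / n) * ∑ v, (d v i - 1 / n) * u v) * u w := by
  have hR : ∑ w, (∑ i, (d w i - 1 / n) * ∑ v, (d v i - 1 / n) * u v) * u w =
      ∑ i, (∑ v, (d v i - 1 / n) * u v) ^ 2 := by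
    calc ∑ w, (∑ i, (d w i - 1 / n) * ∑ v, (d v i - 1 / n) * u v) * u w
        = ∑ w, ∑ i, (d w i - 1 / n) * (∑ v, (d v i - 1 / n) * u v) * u w := by
          simp only [Finset.sum_mul]
      _ = ∑ i, ∑ w, (d w i - 1 / n) * (∑ v, (d v i - 1 / n) * u v) * u w := Finset.sum_comm
      _ = ∑ i, (∑ v, (d v i - 1 / n) * u v) ^ 2 := by
          refine Finset.sum_congr rfl fun i _ => ?_
          rw [sq, Finset.sum_mul]
          exact Finset.sum_congr rfl fun w _ => by ring
  rw [hR]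
  exact contraction_sq_sum_le d hd hrow hcol _

/-- **Gram quadratic form lower bound.** For doubly stochastic `dS`, `dT` with centred profiles
`Δ_S = dS - 1/n`, `Δ_T = dT - 1/n` and Gram matrices `E_S = Δ_S Δ_Sᵀ`, `E_T = Δ_T Δ_Tᵀ`, every
`u` satisfies `-uᵀ E_S E_T u ≤ ‖u‖² / 8` (written out in sums): apply `ball_certificate` to
`x = E_S u`, `y = E_T u`, whose hypotheses `‖x‖² ≤ ⟨x, u⟩`, `‖y‖² ≤ ⟨y, u⟩` say that `E_S`, `E_T`
are positive semidefinite contractions. [folklore] -/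
theorem gram_quadForm_ge {n : ℕ} (dS dT : Fin n → Fin n → ℝ)
    (hS0 : ∀ v i, 0 ≤ dS v i) (hSrow : ∀ v, ∑ i, dS v i = 1) (hScol : ∀ i, ∑ v, dS v i = 1)
    (hT0 : ∀ v i, 0 ≤ dT v i) (hTrow : ∀ v, ∑ i, dT v i = 1) (hTcol : ∀ i, ∑ v, dT v i = 1)
    (u : Fin n → ℝ) :
    -(∑ w, (∑ i, (dS w i - 1 / n) * ∑ v', (dS v' i - 1 / n) * u v') *
        (∑ j, (dT w j - 1 / n) * ∑ v, (dT v j - 1 / n) * u v)) ≤ (∑ v, u v ^ 2) / 8 :=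
  ball_certificate (fun w => ∑ i, (dS w i - 1 / n) * ∑ v', (dS v' i - 1 / n) * u v')
    (fun w => ∑ j, (dT w j - 1 / n) * ∑ v, (dT v j - 1 / n) * u v) u
    (gram_sq_sum_le_gram_inner dS hS0 hSrow hScol u)
    (gram_sq_sum_le_gram_inner dT hT0 hTrow hTcol u)

end Summit.MatrixMultiplication.MatrixMultiplication.Theorems.PolynomialSlack
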